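import Summits.QuantumFields.BalabanUV.T4Continuum.Support.ShellMeasureLinearizedConstraint
import Literature.MathematicalPhysics.QuantumFieldTheory.Balaban1983to89.B12JacobianReal267

/-!
# `T4Continuum.ShellMeasureLinearizedRealForm` — (LR)_j: THE REAL FORM OF PRINT'S LINEARIZING SUBSTITUTION.  The
# COMPLEX data of the tree's B12 leaves (the substitution `B ↦ B − hD̃(B)` of [Balaban1987RG1] p. 267 typed over
# complexified configuration spaces with conjugations) RESTRICTED TO THE REAL FIELDS give the REAL inputs of the
# curved-fibre-chart ENDs: a real right-inverse pair `(L, h)`, real maps `C̃_ℝ`, `D̃_ℝ` with the fixed-point equation on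
# the real window, `D̃_ℝ` globally measurable and Fréchet-differentiable within the window
(cell `pub-balaban`, sub-cell `t4`, spine estimate NE7c (node U5b); NE7c formalisation swarm, crew seat
`b2b-balaban-t4-ne7c-formalise-leaf-02` gen 5 — idle-seat OFFER in the FC orbit (journal `CLAIMS.log`, «REAL FORM OF
PRINT'S SUBSTITUTION»), the «REAL-FORM junction» left open by leaf-09-g7's `ShellMeasureLinearizedConstraint` §2;
imports leaf-09-g7's `ShellMeasureLinearizedConstraint` (p216585) and the Literature leaf `B12JacobianReal267` ONLY
(hence `B12Lineariz267`, `B12LinearizAnalytic267`, `B12JacobianTrLog268`, `B12SecondOrder267`, `B13Contraction113`);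
[folklore]; 0 `def`, 0 `def … : Prop`, 0 sorry, 0 citations — the equation numbers LOCATE displayed shapes)

HONEST FRAMING.  Finite four-torus programme, rung (B)+1 only — NOT infinite volume, NOT a mass gap, NOT the Clay
problem, NOT summit progress; (B), `BetaPertHyp`, (B^μ) not consumed.  NE7c (`T4IndicatorShell.ShellWeightBound`) is
NOT PRINTED and NOT PROVED; «NE7c ⇐ the named binders».  Nothing of [Balaban 1983–89] is asserted: every analytic
input (the quadratic-analytic `C̃`, the right inverse `h`, the solution `D̃` HYPOTHESIS-STYLE with its ball and
fixed-point properties, the conjugations `κ_𝒳`, `κ_𝒴` and their equivariance) is a displayed-TYPE binder EXACTLY as in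
`B12JacobianReal267`, and the REAL FORM is hypothesis-style too: real normed spaces `E`, `F` with real-linear maps
`ιE : E → 𝒴`, `πE : 𝒴 → E` (`πE ∘ ιE = id`, `ιE ∘ πE = id` on the real fields `{κ_𝒴 B = B}`, `ιE` real-valued), and the
same for `F`/`𝒳`.  The concrete real structure of [B12] (`𝔰𝔲(n)`-valued lattice functions) is NOT instantiated.

THE POINT.  The curved-chart ENDs of the FC orbit (leaf-09-g7's `ShellMeasureLinearizedChart` §3–§4 and
`ShellMeasureLinearizedConstraint` §2) take REAL data: a continuous linear `L : E → F` with a continuous linear right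
inverse `h` (`L ∘ h = id`), maps `Ct Dt : E → F` with the fixed-point equation `Ct (B − h (Dt B)) = Dt B` on a window
`O`, a measurable chart `B ↦ B − h (Dt B)` (so `Dt` globally measurable) with a derivative within `O`.  The tree's B12
leaves type print's objects over COMPLEX Banach spaces `𝒴`, `𝒳` («analytic» = holomorphic in the complexified
small-field variables) with the real («𝐠-valued») fields as the fixed vectors of conjugations.  This file restricts:
* §1 reality bookkeeping: `hop` maps real to real (`hop_real`); the REAL right-inverse pair
  `L := πF ∘ LQ ∘ ιE`, `h := πE ∘ hop ∘ ιF` satisfies `L (h b) = b` (`realForm_rightInverse`).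
* §2 the REAL substitution: with `C̃_ℝ := πF ∘ C̃ ∘ ιE` and `D̃_ℝ := 1_O · πF ∘ D̃ ∘ ιE`, `O := {y | ‖ιE y‖ < ε}`:
  `ιE (y − h (D̃_ℝ y)) = ιE y − hop (D̃ (ιE y))` on `O` (`realForm_phi` — `B12JacobianReal267.Dt_real` BY NAME: `D̃` of a
  real field is real) and the FIXED-POINT EQUATION `C̃_ℝ (y − h (D̃_ℝ y)) = D̃_ℝ y` on `O` (`realForm_fix`, from
  `hDfix`).
* §3 regularity: `O` is open and measurable; `D̃_ℝ` is GLOBALLY MEASURABLE (`measurable_realForm_Dt`: continuous on `O`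
  by `B12LinearizAnalytic267.differentiableOn_Dt`, zero off `O`; `ContinuousOn.measurable_piecewise`) and has, within
  `O` at `B ∈ O`, the real Fréchet derivative `πF ∘L (DD̃(ιE B))↾ℝ ∘L ιE` (`hasFDerivWithinAt_realForm_Dt`:
  `B12LinearizAnalytic267.hasStrictFDerivAt_Dt` with scalars restricted, chain rule, local congruence).
So leaf-09-g7's `substitution_linearizes` / `substitution_injOn` / `substitution_hasFDerivWithinAt` /
`average_substitution` and `exists_splitting_of_rightInverse` FIRE on `(L, h, C̃_ℝ, D̃_ℝ, O)` — the displayed «REAL-FORM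
junction» is KERNEL up to the hypothesis-style real form `(ιE, πE, ιF, πF)`; what stays displayed is print's claim that
the block average about the step's background IS `LQ + C̃` with `C̃` quadratic-analytic (node-U0/U5d typing) and the
concrete `𝔰𝔲(n)` real structure.  NOTHING in the countdown moves; NE7c NOT PROVED; spine PROVED 0/9.  HONEST DEPENDENCY
(cell): continuum YM on T⁴ ⇐ BetaPertH ∧ nine spine estimates (0/9 proved); BetaPertH ⇐ (D1) ∧ (D4) ∧ CAP+tail; G-an2-4
gates asym, D1 and NE2/3/4.
-/

noncomputable section

open Set Metric Filter Topology

namespace Summit.QuantumFields.BalabanUV.T4Continuum.ShellMeasureLinearizedRealForm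

open Literature.MathematicalPhysics.QuantumFieldTheory.Balaban1983to89
open B13Contraction113 (QuadAnalytic)
open B12JacobianReal267 (Dt_real phi_real)
open B12LinearizAnalytic267 (differentiableOn_Dt hasStrictFDerivAt_Dt)
open B12SecondOrder267 (norm_phi_lt)

variable {𝒳 𝒴 : Type*} [NormedAddCommGroup 𝒳] [NormedSpace ℂ 𝒳] [CompleteSpace 𝒳]
  [NormedAddCommGroup 𝒴] [NormedSpace ℂ 𝒴] [CompleteSpace 𝒴]
  {hop : 𝒳 →ₗ[ℂ] 𝒴} {Ct : 𝒴 → 𝒳} {C₂ R b ε : ℝ} {Dt : 𝒴 → 𝒳}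
  {κX : 𝒳 ≃ₗᵢ⋆[ℂ] 𝒳} {κY : 𝒴 ≃ₗᵢ⋆[ℂ] 𝒴}
variable {E F : Type*} [NormedAddCommGroup E] [NormedSpace ℝ E] [NormedAddCommGroup F] [NormedSpace ℝ F]
  {ιE : E →L[ℝ] 𝒴} {πE : 𝒴 →L[ℝ] E} {ιF : F →L[ℝ] 𝒳} {πF : 𝒳 →L[ℝ] F}

/-! ## §1 Reality bookkeeping: `hop` on real fields; the real right-inverse pair -/

omit [CompleteSpace 𝒳] [CompleteSpace 𝒴] in
/-- `hop` maps real fields to real fields (equivariance `hop ∘ κ_𝒳 = κ_𝒴 ∘ hop`). [folklore] -/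
theorem hop_real (hhop : ∀ X, hop (κX X) = κY (hop X)) {X : 𝒳} (hX : κX X = X) : κY (hop X) = hop X := by
  rw [← hhop, hX]

omit [CompleteSpace 𝒳] [CompleteSpace 𝒴] in
/-- **THE REAL RIGHT-INVERSE PAIR**: `L := πF ∘ LQ ∘ ιE`, `h := πE ∘ hop ∘ ιF` satisfy `L (h b) = b` — from «LQ̃h = I»,
`hop` real, `ιE ∘ πE = id` on real fields, `πF ∘ ιF = id`. [folklore] -/
theorem realForm_rightInverse (LQ : 𝒴 →L[ℂ] 𝒳) (hLQh : ∀ X, LQ (hop X) = X) (hHop : ∀ X, ‖hop X‖ ≤ b * ‖X‖)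
    (hhop : ∀ X, hop (κX X) = κY (hop X))
    (hιπE : ∀ B, κY B = B → ιE (πE B) = B) (hιFr : ∀ x, κX (ιF x) = ιF x) (hπιF : ∀ x, πF (ιF x) = x) (b' : F) :
    (πF ∘L LQ.restrictScalars ℝ ∘L ιE) ((πE ∘L (hop.mkContinuous b hHop).restrictScalars ℝ ∘L ιF) b') = b' := by
  simp only [ContinuousLinearMap.coe_comp, Function.comp_apply, ContinuousLinearMap.coe_restrictScalars',
    LinearMap.mkContinuous_apply]
  rw [hιπE _ (hop_real hhop (hιFr b')), hLQh, hπιF]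

/-! ## §2 The real substitution and its fixed-point equation -/

omit [CompleteSpace 𝒴] in
/-- **THE REAL CHART IS THE RESTRICTION OF PRINT'S `Φ`**: for `‖ιE y‖ < ε`,
`ιE (y − h (D̃_ℝ y)) = ιE y − hop (D̃ (ιE y))` — `D̃ (ιE y)` is real (`B12JacobianReal267.Dt_real`), `hop` of it is real,
and `ιE ∘ πE` fixes real fields. [folklore] -/
theorem realForm_phi (hC : QuadAnalytic Ct C₂ R) (hC₂ : 0 ≤ C₂) (hb : 0 ≤ b) (hHop : ∀ X, ‖hop X‖ ≤ b * ‖X‖)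
    (hq : 9 * C₂ * b * ε < 1) (hRC : 3 * ε ≤ R)
    (hDball : ∀ B : 𝒴, ‖B‖ < ε → Dt B ∈ closedBall (0:𝒳) (4 * C₂ * ε ^ 2))
    (hDfix : ∀ B : 𝒴, ‖B‖ < ε → Ct (B - hop (Dt B)) = Dt B)
    (hκX : ∀ X, κX (κX X) = X) (hκY : ∀ B, κY (κY B) = B)
    (hhop : ∀ X, hop (κX X) = κY (hop X)) (hCt : ∀ Y : 𝒴, ‖Y‖ < R → Ct (κY Y) = κX (Ct Y))
    (hιπE : ∀ B, κY B = B → ιE (πE B) = B) (hιEr : ∀ y, κY (ιE y) = ιE y)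
    (hιπF : ∀ X, κX X = X → ιF (πF X) = X)
    {y : E} (hy : ‖ιE y‖ < ε) :
    ιE (y - (πE ∘L (hop.mkContinuous b hHop).restrictScalars ℝ ∘L ιF)
        (({y : E | ‖ιE y‖ < ε}).piecewise (fun y => πF (Dt (ιE y))) 0 y)) = ιE y - hop (Dt (ιE y)) := by
  have hDr : κX (Dt (ιE y)) = Dt (ιE y) :=
    Dt_real hC hC₂ hb hHop hq hRC hDball hDfix hκX hκY hhop hCt hy (hιEr y)
  rw [piecewise_eq_of_mem _ _ _ (show y ∈ {y : E | ‖ιE y‖ < ε} from hy)]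
  simp only [map_sub, ContinuousLinearMap.coe_comp, Function.comp_apply, ContinuousLinearMap.coe_restrictScalars',
    LinearMap.mkContinuous_apply]
  rw [hιπF _ hDr, hιπE _ (hop_real hhop hDr)]

omit [CompleteSpace 𝒴] in
/-- **THE FIXED-POINT EQUATION ON THE REAL WINDOW**: `C̃_ℝ (y − h (D̃_ℝ y)) = D̃_ℝ y` for `‖ιE y‖ < ε` — print's
«C̃(B − hD̃(B)) = D̃(B)» (`hDfix`) read on the real fields. [folklore] -/
theorem realForm_fix (hC : QuadAnalytic Ct C₂ R) (hC₂ : 0 ≤ C₂) (hb : 0 ≤ b) (hHop : ∀ X, ‖hop X‖ ≤ b * ‖X‖)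
    (hq : 9 * C₂ * b * ε < 1) (hRC : 3 * ε ≤ R)
    (hDball : ∀ B : 𝒴, ‖B‖ < ε → Dt B ∈ closedBall (0:𝒳) (4 * C₂ * ε ^ 2))
    (hDfix : ∀ B : 𝒴, ‖B‖ < ε → Ct (B - hop (Dt B)) = Dt B)
    (hκX : ∀ X, κX (κX X) = X) (hκY : ∀ B, κY (κY B) = B)
    (hhop : ∀ X, hop (κX X) = κY (hop X)) (hCt : ∀ Y : 𝒴, ‖Y‖ < R → Ct (κY Y) = κX (Ct Y))
    (hιπE : ∀ B, κY B = B → ιE (πE B) = B) (hιEr : ∀ y, κY (ιE y) = ιE y)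
    (hιπF : ∀ X, κX X = X → ιF (πF X) = X) :
    ∀ y ∈ {y : E | ‖ιE y‖ < ε},
      (fun y => πF (Ct (ιE y))) (y - (πE ∘L (hop.mkContinuous b hHop).restrictScalars ℝ ∘L ιF)
        (({y : E | ‖ιE y‖ < ε}).piecewise (fun y => πF (Dt (ιE y))) 0 y)) =
      ({y : E | ‖ιE y‖ < ε}).piecewise (fun y => πF (Dt (ιE y))) 0 y := by
  intro y hy
  have hy' : ‖ιE y‖ < ε := hy
  dsimp only
  rw [realForm_phi hC hC₂ hb hHop hq hRC hDball hDfix hκX hκY hhop hCt hιπE hιEr hιπF hy', hDfix _ hy',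
    piecewise_eq_of_mem _ _ _ hy]

/-! ## §3 Regularity of the real `D̃`: window, measurability, derivative -/

omit [CompleteSpace 𝒳] [CompleteSpace 𝒴] [NormedAddCommGroup F] [NormedSpace ℝ F] in
/-- the real window `O = ιE⁻¹(ball ε)` is open. [folklore] -/
theorem isOpen_realWindow : IsOpen {y : E | ‖ιE y‖ < ε} :=
  isOpen_lt (continuous_norm.comp ιE.continuous) continuous_const

/-- **`D̃_ℝ` IS GLOBALLY MEASURABLE** — continuous on the open window (print's `D̃` is holomorphic on the ball,
`B12LinearizAnalytic267.differentiableOn_Dt`), zero off it. [folklore] -/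
theorem measurable_realForm_Dt [MeasurableSpace E] [OpensMeasurableSpace E] [MeasurableSpace F] [BorelSpace F]
    (hC : QuadAnalytic Ct C₂ R) (hCa : AnalyticOnNhd ℂ Ct {Y : 𝒴 | ‖Y‖ < R})
    (hC₂ : 0 ≤ C₂) (hb : 0 ≤ b) (hHop : ∀ X, ‖hop X‖ ≤ b * ‖X‖) (hq : 9 * C₂ * b * ε < 1)
    (hRC : 3 * ε ≤ R) (hDball : ∀ B : 𝒴, ‖B‖ < ε → Dt B ∈ closedBall (0:𝒳) (4 * C₂ * ε ^ 2))
    (hDfix : ∀ B : 𝒴, ‖B‖ < ε → Ct (B - hop (Dt B)) = Dt B) :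
    Measurable (({y : E | ‖ιE y‖ < ε}).piecewise (fun y => πF (Dt (ιE y))) (0 : E → F)) := by
  have hmaps : MapsTo (ιE : E → 𝒴) {y : E | ‖ιE y‖ < ε} (ball (0 : 𝒴) ε) := fun y hy =>
    mem_ball_zero_iff.2 hy
  have hcont : ContinuousOn (fun y : E => πF (Dt (ιE y))) {y : E | ‖ιE y‖ < ε} :=
    πF.continuous.comp_continuousOn
      ((differentiableOn_Dt hC hCa hC₂ hb hHop hq hRC hDball hDfix).continuousOn.comp
        ιE.continuous.continuousOn hmaps)
  exact hcont.measurable_piecewise continuousOn_const isOpen_realWindow.measurableSet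

/-- **THE REAL DERIVATIVE OF `D̃_ℝ` WITHIN THE WINDOW**: at `B ∈ O`, `D̃_ℝ` has the Fréchet derivative
`πF ∘L (DD̃(ιE B))↾ℝ ∘L ιE` within `O` — print's `(δ/δB)D̃` (`B12LinearizAnalytic267.hasStrictFDerivAt_Dt`) with
scalars restricted to `ℝ`, composed with the real form. [folklore] -/
theorem hasFDerivWithinAt_realForm_Dt (hC : QuadAnalytic Ct C₂ R) (hCa : AnalyticOnNhd ℂ Ct {Y : 𝒴 | ‖Y‖ < R})
    (hC₂ : 0 ≤ C₂) (hb : 0 ≤ b) (hHop : ∀ X, ‖hop X‖ ≤ b * ‖X‖) (hq : 9 * C₂ * b * ε < 1)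
    (hRC : 3 * ε ≤ R) (hDball : ∀ B : 𝒴, ‖B‖ < ε → Dt B ∈ closedBall (0:𝒳) (4 * C₂ * ε ^ 2))
    (hDfix : ∀ B : 𝒴, ‖B‖ < ε → Ct (B - hop (Dt B)) = Dt B) {B : E} (hB : ‖ιE B‖ < ε) :
    HasFDerivWithinAt (({y : E | ‖ιE y‖ < ε}).piecewise (fun y => πF (Dt (ιE y))) (0 : E → F))
      (πF ∘L (fderiv ℂ Dt (ιE B)).restrictScalars ℝ ∘L ιE) {y : E | ‖ιE y‖ < ε} B := by
  have hD : HasFDerivAt Dt (fderiv ℂ Dt (ιE B)) (ιE B) :=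
    (hasStrictFDerivAt_Dt hC hCa hC₂ hb hHop hq hRC hDball hDfix hB).hasFDerivAt.differentiableAt.hasFDerivAt
  have hDℝ : HasFDerivAt Dt ((fderiv ℂ Dt (ιE B)).restrictScalars ℝ) (ιE B) := hD.restrictScalars ℝ
  have hcomp : HasFDerivAt (fun y : E => πF (Dt (ιE y))) (πF ∘L (fderiv ℂ Dt (ιE B)).restrictScalars ℝ ∘L ιE) B :=
    πF.hasFDerivAt.comp B (hDℝ.comp B ιE.hasFDerivAt)
  refine hcomp.hasFDerivWithinAt.congr (fun y hy => ?_) ?_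
  · exact piecewise_eq_of_mem _ _ _ hy
  · exact piecewise_eq_of_mem _ _ _ (show B ∈ {y : E | ‖ιE y‖ < ε} from hB)


/-! ## §4 The junction: leaf-09-g7's real substitution lemmas FIRE on the restricted data -/

section Junction

open ShellMeasureLinearizedConstraint (substitution_linearizes substitution_injOn substitution_hasFDerivWithinAt
  exists_splitting_of_rightInverse average_substitution)

/-- **THE REAL CHART DATA OF THE CURVED-FIBRE ENDs, FROM PRINT'S COMPLEXIFIED SUBSTITUTION.**  Under the binders of
`B12JacobianReal267` (complex `hop`, `C̃`, `D̃` hypothesis-style on `‖B‖ < ε`, analytic `C̃`, conjugations with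
equivariance) and a hypothesis-style real form `(ιE, πE, ιF, πF)`: with `L := πF ∘ LQ ∘ ιE`, `h := πE ∘ hop ∘ ιF`,
`C̃_ℝ := πF ∘ C̃ ∘ ιE`, `D̃_ℝ := 1_O · πF ∘ D̃ ∘ ιE`, `O := {‖ιE ·‖ < ε}` — (i) the real chart `B ↦ B − h (D̃_ℝ B)` is
MEASURABLE, (ii) INJECTIVE on `O` (`ShellMeasureLinearizedConstraint.substitution_injOn`), (iii) has the derivative
`id − h ∘ (πF ∘ DD̃(ιE B)↾ℝ ∘ ιE)` within `O` (`…substitution_hasFDerivWithinAt`), and (iv) LINEARIZES the real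
average `L + C̃_ℝ` into the second coordinate of ANY splitting `Ψ` with `(Ψ.symm y).2 = L y`
(`…substitution_linearizes`) — the hypotheses `hΦm`/`hinj`/`hΦ'`/`hlin` of `ShellMeasureLinearizedChart` §3–§4 for this
chart. [folklore] -/
theorem realForm_chartData [MeasurableSpace E] [BorelSpace E] [FiniteDimensional ℝ E] [MeasurableSpace F]
    [BorelSpace F] (LQ : 𝒴 →L[ℂ] 𝒳) (hLQh : ∀ X, LQ (hop X) = X)
    (hC : QuadAnalytic Ct C₂ R) (hCa : AnalyticOnNhd ℂ Ct {Y : 𝒴 | ‖Y‖ < R})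
    (hC₂ : 0 ≤ C₂) (hb : 0 ≤ b) (hHop : ∀ X, ‖hop X‖ ≤ b * ‖X‖) (hq : 9 * C₂ * b * ε < 1)
    (hRC : 3 * ε ≤ R) (hDball : ∀ B : 𝒴, ‖B‖ < ε → Dt B ∈ closedBall (0:𝒳) (4 * C₂ * ε ^ 2))
    (hDfix : ∀ B : 𝒴, ‖B‖ < ε → Ct (B - hop (Dt B)) = Dt B)
    (hκX : ∀ X, κX (κX X) = X) (hκY : ∀ B, κY (κY B) = B)
    (hhop : ∀ X, hop (κX X) = κY (hop X)) (hCt : ∀ Y : 𝒴, ‖Y‖ < R → Ct (κY Y) = κX (Ct Y))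
    (hιπE : ∀ B, κY B = B → ιE (πE B) = B) (hιEr : ∀ y, κY (ιE y) = ιE y)
    (hιπF : ∀ X, κX X = X → ιF (πF X) = X) (hιFr : ∀ x, κX (ιF x) = ιF x) (hπιF : ∀ x, πF (ιF x) = x)
    {Kf : Type*} [NormedAddCommGroup Kf] [NormedSpace ℝ Kf] (Ψ : (Kf × F) ≃L[ℝ] E)
    (hΨ : ∀ y, (Ψ.symm y).2 = (πF ∘L LQ.restrictScalars ℝ ∘L ιE) y) :
    Measurable (fun B : E => B - (πE ∘L (hop.mkContinuous b hHop).restrictScalars ℝ ∘L ιF)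
        (({y : E | ‖ιE y‖ < ε}).piecewise (fun y => πF (Dt (ιE y))) 0 B)) ∧
      InjOn (fun B : E => B - (πE ∘L (hop.mkContinuous b hHop).restrictScalars ℝ ∘L ιF)
        (({y : E | ‖ιE y‖ < ε}).piecewise (fun y => πF (Dt (ιE y))) 0 B)) {y : E | ‖ιE y‖ < ε} ∧
      (∀ B ∈ {y : E | ‖ιE y‖ < ε}, HasFDerivWithinAt
        (fun B : E => B - (πE ∘L (hop.mkContinuous b hHop).restrictScalars ℝ ∘L ιF)
          (({y : E | ‖ιE y‖ < ε}).piecewise (fun y => πF (Dt (ιE y))) 0 B))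
        (ContinuousLinearMap.id ℝ E - (πE ∘L (hop.mkContinuous b hHop).restrictScalars ℝ ∘L ιF).comp
          (πF ∘L (fderiv ℂ Dt (ιE B)).restrictScalars ℝ ∘L ιE)) {y : E | ‖ιE y‖ < ε} B) ∧
      ∀ B ∈ {y : E | ‖ιE y‖ < ε},
        (πF ∘L LQ.restrictScalars ℝ ∘L ιE) (B - (πE ∘L (hop.mkContinuous b hHop).restrictScalars ℝ ∘L ιF)
            (({y : E | ‖ιE y‖ < ε}).piecewise (fun y => πF (Dt (ιE y))) 0 B)) +
          (fun y => πF (Ct (ιE y))) (B - (πE ∘L (hop.mkContinuous b hHop).restrictScalars ℝ ∘L ιF)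
            (({y : E | ‖ιE y‖ < ε}).piecewise (fun y => πF (Dt (ιE y))) 0 B)) = (Ψ.symm B).2 := by
  have hfix := realForm_fix hC hC₂ hb hHop hq hRC hDball hDfix hκX hκY hhop hCt hιπE hιEr hιπF
  refine ⟨?_, ?_, fun B hB => ?_, ?_⟩
  · exact measurable_id.sub ((πE ∘L (hop.mkContinuous b hHop).restrictScalars ℝ ∘L ιF).continuous.measurable.comp
      (measurable_realForm_Dt hC hCa hC₂ hb hHop hq hRC hDball hDfix))
  · exact substitution_injOn (πE ∘L (hop.mkContinuous b hHop).restrictScalars ℝ ∘L ιF) (fun y => πF (Ct (ιE y)))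
      (({y : E | ‖ιE y‖ < ε}).piecewise (fun y => πF (Dt (ιE y))) 0) hfix
  · exact substitution_hasFDerivWithinAt _ _ (hasFDerivWithinAt_realForm_Dt hC hCa hC₂ hb hHop hq hRC hDball hDfix hB)
  · exact substitution_linearizes (πF ∘L LQ.restrictScalars ℝ ∘L ιE)
      (πE ∘L (hop.mkContinuous b hHop).restrictScalars ℝ ∘L ιF)
      (realForm_rightInverse LQ hLQh hHop hhop hιπE hιFr hπιF) (fun y => πF (Ct (ιE y)))
      (({y : E | ‖ιE y‖ < ε}).piecewise (fun y => πF (Dt (ιE y))) 0) hfix Ψ hΨ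

end Junction

end Summit.QuantumFields.BalabanUV.T4Continuum.ShellMeasureLinearizedRealForm

end
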